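import Summits.BirchSwinnertonDyer.BirchSwinnertonDyer.Theorems.KolyvaginDepthDoorDepthTableKuriharaExactRow
import Summits.BirchSwinnertonDyer.BirchSwinnertonDyer.Theorems.KolyvaginDepthDoorDepthTableKuriharaESideFive2
import Summits.BirchSwinnertonDyer.BirchSwinnertonDyer.Theorems.KolyvaginDepthDoorDepthTableRow817a1RankDischarged
import Literature.NumberTheory.EllipticCurves.BSDSelmerPConverseSerreProofs
import HarnessLib

/-!
# Route `KolyvaginDepthDoor`, crux `KolyvaginDepthSupplyKN` (stmt-BirchSwinnertonDyer-22820) —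
# DEPTH TABLE v18, ROW `817a1` @ `(5, d_K = −8)`: the SOCKET for the fleet's twist record and the EXACT depth-one
# reading in Kurihara currency (twist model `T₀ = [0, 1, 0, 3, -47]` = `817a1^{(−8)}`, conductor `52288`)

Helper file of the lead prover of line `levelone` (kdd-p1 g22; `--supports stmt-BirchSwinnertonDyer-22820
--as helper`); it closes nothing and BSD is NOT proved by it. Template for the open rows whose twist model lies in
the kurihara fleet's conductor range (CLOSING-DATA-v17/v18).

The E-side of this row is in the tree (g21: `C817a1.sha_inf_torsionBy_five_eq_bot_of_kuriharaClaim` — `Ш(817a1)[5] = 0`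
from the record `cert_817a1` @ `(5, 31·401)`, claim `hδE`); every side condition of `E = 817a1` and of the minimal twist
model `T₀` at `p = 5` is a kernel theorem of the lineage (`goodOrdinary_5`, `hasSurjectiveModNGaloisRep_pow_5`,
`nonAnomalous_5`, `kodairaNeron_of_five_le`, `spadeOne_of_five_le`, `heegner_neg8`, `Rank2Observatory.C817a1.mordellWeilRank_eq_two`;
`minTwist8_isElliptic/_isGloballyMinimal/_smul_eq/_card_5/_kodairaNeron_5`). What is OWED is one datum on `T₀`:

* `minTwist8_nonAnomalous_5` — `a_5(T₀) = 2 ≢ 1 (mod 5)` (kernel: `#T̃₀(𝔽_5) = 4`).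
* `cruxBody_of_twistKuriharaClaim_5_neg8` — **THE SOCKET**: for every `K` with `d_K = −8`, IF some cyclic Kolyvagin
  level `m` of `(T₀, 5)` with `ν(m) ≤ 2` carries a unit mod-`5` Kurihara number (the CLAIM of a future tree record
  `cert_<T₀>` at `(5, m)`, hypothesis `hδT`; `m`, its cyclicity `hm` and `ν(m) ≤ 2` are the record's data), THEN the
  clause of `KolyvaginDepthSupplyKN` holds at `W = 817a1` verbatim — v17's `cruxBody_of_kuriharaClaims_spade` with every
  other input discharged (E-side claim `hδE` of the existing record; Kim Thm. 1.11, modularity, Mazur Cor. 4.1,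
  W. Zhang L8.4 (1)/9.1 BY NAME).
* `kolyvaginPrime_iff_twistKuriharaBit_5_neg8` — **THE EXACT DEPTH-ONE READING**: granted the E-side claim `hδE`,
  «∃ frame, Kolyvagin PRIME `ℓ`, datum with `c_1(ℓ) ≠ 0`» (the depth-table bit of the route's CHEAPEST FALSIFIER at
  this row) ⟺ «for every admissible datum of `T₀`, some cyclic Kolyvagin level of `(T₀, 5)` of depth `≤ 1` carries a
  unit mod-`5` Kurihara number» — g14/g20's `exactRowZhang_5_neg8_rankFree` («bit ⟺ Ш(E)[5] = 0 ∧ #Sel_5(E^{(−8)}) ≤ 5»)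
  composed with v18's `natCard_selmerGroup_quadraticTwist_le_iff_kuriharaBit` (Sakamoto Thm. 1.2/1.5 + Kim Thm. 1.11 BY
  NAME). The fleet's datum for this row is therefore EXACTLY one residue `δ̃_ℓ(T₀) mod 5` at a cyclic Kolyvagin prime
  `ℓ` of `(T₀, 5)` (`ℓ ∤ 5·52288`, `ℓ ≡ 1 (mod 5)`, `a_ℓ(T₀) ≡ 2 (mod 5)`, `25 ∤ #T̃₀(𝔽_ℓ)`).

CONDITIONAL on the named facts displayed (`hKim`, `hSak1`, `hSak2`, `hnf`, `hMaz`, `h372`, `h84`) and on the record claims;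
per curve; nothing class-wide; BSD is NOT proved by any of this.

References: [Sakamoto2022pSelmer] Thm. 1.2, Thm. 1.5; [Kim2022StructureSelmer] Thm. 1.11, §1.2.2; [WZhang2014] Lemma 8.4 (1),
Thm. 9.1; [GrossLMS1991] Prop. 3.7 (2); [Mazur1978] Cor. 4.1; [CremonaAlgorithms1997] Table 1 (817a1); [SilvermanAEC2009]
VII.3.1, X.4.2, X.5 Cor. 5.4.
-/

set_option linter.dupNamespace false

noncomputable section

open scoped Classical NumberField

namespace Summit.BirchSwinnertonDyer.BirchSwinnertonDyer.Theorems.KolyvaginDepthDoor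

open Literature.NumberTheory.EllipticCurves Literature.NumberTheory.EllipticCurves.ModularForms
  WeierstrassCurve NumberField IsDedekindDomain
open Summit.BirchSwinnertonDyer.BirchSwinnertonDyer.Theorems
open Summit.BirchSwinnertonDyer.BirchSwinnertonDyer.Rank2Observatory
open Summit.BirchSwinnertonDyer.BirchSwinnertonDyer.Rank1Residual (IntModel.frobeniusTrace_eq)

namespace C817a1

/-- **`5` is non-anomalous for the twist model `T₀ = [0, 1, 0, 3, -47]`**: `#T̃₀(𝔽_5) = 4`, `a_5(T₀) = 2`,
`5 ∤ a_5(T₀) − 1` (Sakamoto's hypothesis (c) / Kim's (iii) for `T₀`). [cite: SilvermanAEC2009, VII.3 Prop. 3.1] -/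
theorem minTwist8_nonAnomalous_5 :
    haveI := minTwist8_isGloballyMinimal; haveI := Fact.mk (by norm_num : Nat.Prime 5);
    ¬ ((5 : ℕ) : ℤ) ∣ ((⟨0, 1, 0, 3, -47⟩ : WeierstrassCurve ℤ).map (Int.castRingHom ℚ)).frobeniusTrace 5 - 1 := by
  haveI := minTwist8_isElliptic
  haveI := minTwist8_isGloballyMinimal
  haveI := Fact.mk (by norm_num : Nat.Prime 5)
  rw [IntModel.frobeniusTrace_eq minTwist8_intModel minTwist8_card_5]
  decide

/-- **THE SOCKET for row `817a1` @ `(5, −8)`: the clause of `KolyvaginDepthSupplyKN` at `W = 817a1` from the EXISTING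
E-side record claim and ONE FUTURE twist record claim.** For every imaginary quadratic `K` with `d_K = −8`: granted
Kim Thm. 1.11 (`hKim`), modularity (`hnf`), Mazur Cor. 4.1 (`hMaz`), W. Zhang L8.4 (1)/9.1 (`h84`) BY NAME, the claim
`hδE` of the tree record `cert_817a1` @ `(5, 12431 = 31·401)`, and — THE DATUM OWED — a cyclic Kolyvagin level `m` of
`(T₀, 5)` (`hm`) of depth `ν(m) ≤ 2` (`hμ`) whose claim `hδT` holds (a unit mod-`5` Kurihara number of `T₀` at `m` for
every admissible datum), the crux's clause holds at `817a1` VERBATIM. All side conditions are kernel theorems of the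
lineage (module docstring). CONDITIONAL on the four named facts and the two claims; per curve; BSD is not proved by it.
[cite: Kim2022StructureSelmer, Thm. 1.11 (PDF p. 8)] [cite: WZhang2014, Lemma 8.4 (1) (p. 236), Thm. 9.1 (p. 240)]
[cite: Mazur1978, Cor. 4.1] [cite: CremonaAlgorithms1997, Table 1 (817a1)] -/
theorem cruxBody_of_twistKuriharaClaim_5_neg8
    (hKim : Kim2022_card_selmerGroup_le_pow_of_kuriharaNumber_ne_zero)
    (hnf : exists_isNewformOf) (hMaz : mazur_not_dvd_maninConstant_of_odd)
    (h84 : Literature.NumberTheory.EllipticCurves.WZhang2014_lemma84_exists_minimal_kolyvaginClass_one_selmerCard)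
    (K : Type) [Field K] [NumberField K] (hK : IsImaginaryQuadratic K) (hD : NumberField.discr K = -8)
    (hδE : haveI := isElliptic_c817a1; haveI := isGloballyMinimal_c817a1;
      haveI : NeZero (((⟨0, 1, 1, 1, 6⟩ : WeierstrassCurve ℤ).map (Int.castRingHom ℚ)).conductorNorm ℤ) := neZero_conductorNorm_of_isElliptic _;
      haveI := Fact.mk (by norm_num : Nat.Prime 5);
      ∀ (D : ModularParametrizationData ((⟨0, 1, 1, 1, 6⟩ : WeierstrassCurve ℤ).map (Int.castRingHom ℚ)) (((⟨0, 1, 1, 1, 6⟩ : WeierstrassCurve ℤ).map (Int.castRingHom ℚ)).conductorNorm ℤ)), ¬ ((5 : ℕ) : ℤ) ∣ D.maninConstant →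
        (∃ u : ℚ, ‖(u : ℚ_[5])‖ = 1 ∧ ((⟨0, 1, 1, 1, 6⟩ : WeierstrassCurve ℤ).map (Int.castRingHom ℚ)).realPeriodRat = u * plusPeriod D.f) →
        ∃ ψ : (ℓ : ℕ) → (ZMod ℓ)ˣ →* Multiplicative (ZMod 5),
          (∀ ℓ ∈ (12431 : ℕ).primeFactors, Function.Surjective (ψ ℓ)) ∧ kuriharaNumber D.f 5 12431 ψ ≠ 0)
    (m : ℕ) [NeZero m]
    (hm : haveI := minTwist8_isGloballyMinimal;
      IsCyclicKolyvaginLevel ((⟨0, 1, 0, 3, -47⟩ : WeierstrassCurve ℤ).map (Int.castRingHom ℚ)) 5 m)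
    (hμ : m.primeFactors.card ≤ 2)
    (hδT : haveI := minTwist8_isElliptic; haveI := minTwist8_isGloballyMinimal;
      haveI : NeZero (((⟨0, 1, 0, 3, -47⟩ : WeierstrassCurve ℤ).map (Int.castRingHom ℚ)).conductorNorm ℤ) :=
        neZero_conductorNorm_of_isElliptic _;
      haveI := Fact.mk (by norm_num : Nat.Prime 5);
      ∀ (D : ModularParametrizationData ((⟨0, 1, 0, 3, -47⟩ : WeierstrassCurve ℤ).map (Int.castRingHom ℚ))
          (((⟨0, 1, 0, 3, -47⟩ : WeierstrassCurve ℤ).map (Int.castRingHom ℚ)).conductorNorm ℤ)),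
        ¬ ((5 : ℕ) : ℤ) ∣ D.maninConstant →
        (∃ u : ℚ, ‖(u : ℚ_[5])‖ = 1 ∧
          ((⟨0, 1, 0, 3, -47⟩ : WeierstrassCurve ℤ).map (Int.castRingHom ℚ)).realPeriodRat = u * plusPeriod D.f) →
        ∃ ψ : (ℓ : ℕ) → (ZMod ℓ)ˣ →* Multiplicative (ZMod 5),
          (∀ ℓ ∈ m.primeFactors, Function.Surjective (ψ ℓ)) ∧ kuriharaNumber D.f 5 m ψ ≠ 0) :
    haveI := isElliptic_c817a1; haveI := isGloballyMinimal_c817a1;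
    ∃ (p : ℕ) (hp : Fact p.Prime), 5 ≤ p ∧ ((⟨0, 1, 1, 1, 6⟩ : WeierstrassCurve ℤ).map (Int.castRingHom ℚ)).HasGoodReductionAtPrime p ∧
      ¬ (p : ℤ) ∣ ((⟨0, 1, 1, 1, 6⟩ : WeierstrassCurve ℤ).map (Int.castRingHom ℚ)).frobeniusTrace p ∧
      (∀ n : ℕ, ((⟨0, 1, 1, 1, 6⟩ : WeierstrassCurve ℤ).map (Int.castRingHom ℚ)).HasSurjectiveModNGaloisRep (p ^ n : ℕ)) ∧
      (∀ v : HeightOneSpectrum (𝓞 ℚ), ((⟨0, 1, 1, 1, 6⟩ : WeierstrassCurve ℤ).map (Int.castRingHom ℚ)).HasMultiplicativeReductionAt v →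
        ¬ p ∣ ((⟨0, 1, 1, 1, 6⟩ : WeierstrassCurve ℤ).map (Int.castRingHom ℚ)).ordMinimalDiscriminant v) ∧
      ∃ (K : Type) (_ : Field K) (_ : NumberField K), IsImaginaryQuadratic K ∧
        NumberField.discr K ≠ -3 ∧ NumberField.discr K ≠ -4 ∧
        ∃ (_ : NeZero (((⟨0, 1, 1, 1, 6⟩ : WeierstrassCurve ℤ).map (Int.castRingHom ℚ)).conductorNorm ℤ)),
          SatisfiesHeegnerHypothesis (((⟨0, 1, 1, 1, 6⟩ : WeierstrassCurve ℤ).map (Int.castRingHom ℚ)).conductorNorm ℤ) K ∧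
        ∃ (Dt : ModularParametrizationData ((⟨0, 1, 1, 1, 6⟩ : WeierstrassCurve ℤ).map (Int.castRingHom ℚ)) (((⟨0, 1, 1, 1, 6⟩ : WeierstrassCurve ℤ).map (Int.castRingHom ℚ)).conductorNorm ℤ))
          (β : ℤ) (ι : K →+* ℂ) (n₁ : ℕ) (d : KolyvaginHeegnerData Dt β ι n₁), Squarefree n₁ ∧
          (∀ q ∈ n₁.primeFactors, Zhang2014.IsKolyvaginPrime (((⟨0, 1, 1, 1, 6⟩ : WeierstrassCurve ℤ).map (Int.castRingHom ℚ)).conductorNorm ℤ)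
            ((⟨0, 1, 1, 1, 6⟩ : WeierstrassCurve ℤ).map (Int.castRingHom ℚ)) K p q) ∧
          d.kolyvaginClass hp.out 1 ≠ 0 ∧
          (n₁.primeFactors.card + 1 ≤ ((⟨0, 1, 1, 1, 6⟩ : WeierstrassCurve ℤ).map (Int.castRingHom ℚ)).mordellWeilRank ∨
            (n₁.primeFactors.card ≤ ((⟨0, 1, 1, 1, 6⟩ : WeierstrassCurve ℤ).map (Int.castRingHom ℚ)).mordellWeilRank ∧
              n₁.primeFactors.card + 1 ≤ (((⟨0, 1, 1, 1, 6⟩ : WeierstrassCurve ℤ).map (Int.castRingHom ℚ)).quadraticTwist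
                (NumberField.discr K : ℚ)).mordellWeilRank)) := by
  haveI := isElliptic_c817a1
  haveI := isGloballyMinimal_c817a1
  haveI iNZ : NeZero (((⟨0, 1, 1, 1, 6⟩ : WeierstrassCurve ℤ).map (Int.castRingHom ℚ)).conductorNorm ℤ) :=
    neZero_conductorNorm_of_isElliptic _
  haveI := minTwist8_isElliptic
  haveI := minTwist8_isGloballyMinimal
  haveI iNZT : NeZero (((⟨0, 1, 0, 3, -47⟩ : WeierstrassCurve ℤ).map (Int.castRingHom ℚ)).conductorNorm ℤ) :=
    neZero_conductorNorm_of_isElliptic _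
  haveI iP := Fact.mk (by norm_num : Nat.Prime 5)
  haveI : NeZero (12431 : ℕ) := ⟨by norm_num⟩
  have hsp := spadeOne_of_five_le 5 le_rfl
  have hS2 : ¬ Squarefree (((⟨0, 1, 1, 1, 6⟩ : WeierstrassCurve ℤ).map (Int.castRingHom ℚ)).conductorNorm ℤ) →
      (∃ (ℓ : ℕ) (_ : Fact ℓ.Prime), ((⟨0, 1, 1, 1, 6⟩ : WeierstrassCurve ℤ).map (Int.castRingHom ℚ)).HasMultiplicativeReductionAtPrime ℓ ∧
          ¬ 5 ∣ padicValInt ℓ ((⟨0, 1, 1, 1, 6⟩ : WeierstrassCurve ℤ).map (Int.castRingHom ℚ)).minimalDiscriminantInt) ∧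
        ∃ (ℓ₁ ℓ₂ : ℕ) (_ : Fact ℓ₁.Prime) (_ : Fact ℓ₂.Prime), ℓ₁ ≠ ℓ₂ ∧
          ((⟨0, 1, 1, 1, 6⟩ : WeierstrassCurve ℤ).map (Int.castRingHom ℚ)).HasMultiplicativeReductionAtPrime ℓ₁ ∧
          ((⟨0, 1, 1, 1, 6⟩ : WeierstrassCurve ℤ).map (Int.castRingHom ℚ)).HasMultiplicativeReductionAtPrime ℓ₂ :=
    fun hns ↦ absurd ((((⟨0, 1, 1, 1, 6⟩ : WeierstrassCurve ℤ).map (Int.castRingHom ℚ))).isSemistable_iff_squarefree_conductorNorm.mp hsp.2) hns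
  have hH := satisfiesHeegnerHypothesis_conductorNorm_of_intModel intModel K hK.1 hD heegner_neg8
  have hD3 : NumberField.discr K ≠ -3 := by rw [hD]; norm_num
  have hD4 : NumberField.discr K ≠ -4 := by rw [hD]; norm_num
  have hpD : ¬ (((5 : ℕ) : ℤ) ∣ NumberField.discr K) := by rw [hD]; decide
  have hsur : ((⟨0, 1, 1, 1, 6⟩ : WeierstrassCurve ℤ).map (Int.castRingHom ℚ)).HasSurjectiveModNGaloisRep ((5 : ℕ) : ℤ) := by
    simpa using hasSurjectiveModNGaloisRep_pow_5 1
  have htower : ∀ k : ℕ, ((⟨0, 1, 1, 1, 6⟩ : WeierstrassCurve ℤ).map (Int.castRingHom ℚ)).HasSurjectiveModNGaloisRep ((5 : ℕ) ^ k : ℕ) :=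
    serre_hasSurjectiveModNGaloisRep_pow_holds _ 5 le_rfl hsur
  have hC : (⟨Units.mk0 ((1 : ℚ) / 2) (by norm_num), (-1 : ℚ), (0 : ℚ), (0 : ℚ)⟩ : WeierstrassCurve.VariableChange ℚ) •
      ((⟨0, 1, 0, 3, -47⟩ : WeierstrassCurve ℤ).map (Int.castRingHom ℚ)) =
      ((⟨0, 1, 1, 1, 6⟩ : WeierstrassCurve ℤ).map (Int.castRingHom ℚ)).quadraticTwist (NumberField.discr K : ℚ) := by
    rw [hD]; push_cast; exact minTwist8_smul_eq
  have hrank : 2 ≤ ((⟨0, 1, 1, 1, 6⟩ : WeierstrassCurve ℤ).map (Int.castRingHom ℚ)).mordellWeilRank :=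
    KernelCertsR01.C817a1.two_le_rank
  have hr2 := Summit.BirchSwinnertonDyer.BirchSwinnertonDyer.Rank2Observatory.C817a1.mordellWeilRank_eq_two
  have hν' : (12431 : ℕ).primeFactors.card ≤ ((⟨0, 1, 1, 1, 6⟩ : WeierstrassCurve ℤ).map (Int.castRingHom ℚ)).mordellWeilRank := by
    rw [hr2, show (12431 : ℕ) = 31 * 401 from rfl, Nat.primeFactors_mul (by norm_num) (by norm_num),
      Nat.Prime.primeFactors (by norm_num), Nat.Prime.primeFactors (by norm_num)]
    decide
  have hμ' : m.primeFactors.card ≤ ((⟨0, 1, 1, 1, 6⟩ : WeierstrassCurve ℤ).map (Int.castRingHom ℚ)).mordellWeilRank := by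
    rw [hr2]; exact hμ
  exact cruxBody_of_kuriharaClaims_spade hKim hnf hMaz h84 _ hrank 5 le_rfl goodOrdinary_5.1 goodOrdinary_5.2 htower
    (kodairaNeron_of_five_le 5 le_rfl) nonAnomalous_5 hsp.1 hS2 K hK hD3 hD4 hpD hH 12431 isCyclicKolyvaginLevel_5_12431 hν' hδE
    ((⟨0, 1, 0, 3, -47⟩ : WeierstrassCurve ℤ).map (Int.castRingHom ℚ)) _ hC minTwist8_nonAnomalous_5
    minTwist8_kodairaNeron_5 m hm hμ' hδT

/-- **THE EXACT DEPTH-ONE READING of row `817a1` @ `(5, −8)` in Kurihara currency.** Granted the E-side claim `hδE`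
(record `cert_817a1` @ `(5, 31·401)`; with Kim Thm. 1.11 it gives `Ш(817a1)[5] = 0`) and the named facts displayed:
for every `K` with `d_K = −8`, «some frame, some Kolyvagin PRIME `ℓ`, some Kolyvagin–Heegner datum of conductor `ℓ`
with `c_1(ℓ) ≠ 0`» (the depth-table bit, route CHEAPEST FALSIFIER) holds IF AND ONLY IF «for every datum `D` of
`T₀ = [0, 1, 0, 3, -47]` at level `N_{T₀}` with `5 ∤ c_D` and the period transfer, some cyclic Kolyvagin level `m`
of `(T₀, 5)` with `ν(m) ≤ 1` carries a unit mod-`5` Kurihara number» — `exactRowZhang_5_neg8_rankFree` («bit ⟺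
Ш(E)[5] = 0 ∧ #Sel_5(E^{(−8)}) ≤ 5», (γ) + W. Zhang by name, rank `= 2` by kernel 2-descent) ∘ v18's twist IFF
(Sakamoto Thm. 1.2/1.5 + Kim Thm. 1.11 + modularity + Mazur by name). So the row's missing datum is EXACTLY one
residue `δ̃_ℓ(T₀) mod 5` at a cyclic Kolyvagin prime `ℓ` of `(T₀, 5)` (conductor `N_{T₀} = 52288`, inside the
kurihara fleet's range). CONDITIONAL on the seven named facts and the claim `hδE`; per curve; BSD is not proved by it.
[cite: Sakamoto2022pSelmer, Thm. 1.2, Thm. 1.5] [cite: Kim2022StructureSelmer, Thm. 1.11] [cite: WZhang2014, Lemma 8.4 (1) (p. 236)]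
[cite: GrossLMS1991, Prop. 3.7 (2), §5 (5.1)] [cite: CremonaAlgorithms1997, Table 1 (817a1)] -/
theorem kolyvaginPrime_iff_twistKuriharaBit_5_neg8
    (h372 : GrossLMS1991.prop37_2_frobeniusCongruence)
    (h84 : Literature.NumberTheory.EllipticCurves.WZhang2014_lemma84_exists_minimal_kolyvaginClass_one_selmerCard)
    (hKim : Kim2022_card_selmerGroup_le_pow_of_kuriharaNumber_ne_zero)
    (hSak1 : Sakamoto2022_card_selmerGroup_eq_pow_of_isDeltaMinimal)
    (hSak2 : Sakamoto2022_exists_cyclicLevel_kuriharaNumber_ne_zero)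
    (hnf : exists_isNewformOf) (hMaz : mazur_not_dvd_maninConstant_of_odd)
    (K : Type) [Field K] [NumberField K] (hK : IsImaginaryQuadratic K) (hD : NumberField.discr K = -8)
    (hδE : haveI := isElliptic_c817a1; haveI := isGloballyMinimal_c817a1;
      haveI : NeZero (((⟨0, 1, 1, 1, 6⟩ : WeierstrassCurve ℤ).map (Int.castRingHom ℚ)).conductorNorm ℤ) := neZero_conductorNorm_of_isElliptic _;
      haveI := Fact.mk (by norm_num : Nat.Prime 5);
      ∀ (D : ModularParametrizationData ((⟨0, 1, 1, 1, 6⟩ : WeierstrassCurve ℤ).map (Int.castRingHom ℚ)) (((⟨0, 1, 1, 1, 6⟩ : WeierstrassCurve ℤ).map (Int.castRingHom ℚ)).conductorNorm ℤ)), ¬ ((5 : ℕ) : ℤ) ∣ D.maninConstant →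
        (∃ u : ℚ, ‖(u : ℚ_[5])‖ = 1 ∧ ((⟨0, 1, 1, 1, 6⟩ : WeierstrassCurve ℤ).map (Int.castRingHom ℚ)).realPeriodRat = u * plusPeriod D.f) →
        ∃ ψ : (ℓ : ℕ) → (ZMod ℓ)ˣ →* Multiplicative (ZMod 5),
          (∀ ℓ ∈ (12431 : ℕ).primeFactors, Function.Surjective (ψ ℓ)) ∧ kuriharaNumber D.f 5 12431 ψ ≠ 0) :
    haveI := isElliptic_c817a1; haveI := isGloballyMinimal_c817a1;
    haveI : NeZero (((⟨0, 1, 1, 1, 6⟩ : WeierstrassCurve ℤ).map (Int.castRingHom ℚ)).conductorNorm ℤ) := neZero_conductorNorm_of_isElliptic _;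
    haveI := minTwist8_isElliptic; haveI := minTwist8_isGloballyMinimal;
    haveI : NeZero (((⟨0, 1, 0, 3, -47⟩ : WeierstrassCurve ℤ).map (Int.castRingHom ℚ)).conductorNorm ℤ) := neZero_conductorNorm_of_isElliptic _;
    haveI := Fact.mk (by norm_num : Nat.Prime 5);
    (∃ (Dt : ModularParametrizationData ((⟨0, 1, 1, 1, 6⟩ : WeierstrassCurve ℤ).map (Int.castRingHom ℚ)) (((⟨0, 1, 1, 1, 6⟩ : WeierstrassCurve ℤ).map (Int.castRingHom ℚ)).conductorNorm ℤ)) (β : ℤ)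
      (ι : K →+* ℂ) (ℓ : ℕ) (d : KolyvaginHeegnerData Dt β ι ℓ),
      ℓ.Prime ∧ Zhang2014.IsKolyvaginPrime (((⟨0, 1, 1, 1, 6⟩ : WeierstrassCurve ℤ).map (Int.castRingHom ℚ)).conductorNorm ℤ) ((⟨0, 1, 1, 1, 6⟩ : WeierstrassCurve ℤ).map (Int.castRingHom ℚ)) K 5 ℓ ∧
        d.kolyvaginClass (p := 5) (by norm_num) 1 ≠ 0) ↔
    (∀ (D : ModularParametrizationData ((⟨0, 1, 0, 3, -47⟩ : WeierstrassCurve ℤ).map (Int.castRingHom ℚ))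
          (((⟨0, 1, 0, 3, -47⟩ : WeierstrassCurve ℤ).map (Int.castRingHom ℚ)).conductorNorm ℤ)),
        ¬ ((5 : ℕ) : ℤ) ∣ D.maninConstant →
        (∃ u : ℚ, ‖(u : ℚ_[5])‖ = 1 ∧
          ((⟨0, 1, 0, 3, -47⟩ : WeierstrassCurve ℤ).map (Int.castRingHom ℚ)).realPeriodRat = u * plusPeriod D.f) →
        ∃ (m : ℕ) (_ : NeZero m), IsCyclicKolyvaginLevel ((⟨0, 1, 0, 3, -47⟩ : WeierstrassCurve ℤ).map (Int.castRingHom ℚ)) 5 m ∧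
          m.primeFactors.card ≤ 1 ∧
          ∃ ψ : (ℓ : ℕ) → (ZMod ℓ)ˣ →* Multiplicative (ZMod 5),
            (∀ ℓ ∈ m.primeFactors, Function.Surjective (ψ ℓ)) ∧ kuriharaNumber D.f 5 m ψ ≠ 0) := by
  haveI := isElliptic_c817a1
  haveI := isGloballyMinimal_c817a1
  haveI iNZ : NeZero (((⟨0, 1, 1, 1, 6⟩ : WeierstrassCurve ℤ).map (Int.castRingHom ℚ)).conductorNorm ℤ) :=
    neZero_conductorNorm_of_isElliptic _
  haveI := minTwist8_isElliptic
  haveI := minTwist8_isGloballyMinimal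
  haveI iNZT : NeZero (((⟨0, 1, 0, 3, -47⟩ : WeierstrassCurve ℤ).map (Int.castRingHom ℚ)).conductorNorm ℤ) :=
    neZero_conductorNorm_of_isElliptic _
  haveI iP := Fact.mk (by norm_num : Nat.Prime 5)
  have hsha := sha_inf_torsionBy_five_eq_bot_of_kuriharaClaim hKim hnf hMaz hδE
  have hsur : ((⟨0, 1, 1, 1, 6⟩ : WeierstrassCurve ℤ).map (Int.castRingHom ℚ)).HasSurjectiveModNGaloisRep ((5 : ℕ) : ℤ) := by
    simpa using hasSurjectiveModNGaloisRep_pow_5 1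
  have hC : (⟨Units.mk0 ((1 : ℚ) / 2) (by norm_num), (-1 : ℚ), (0 : ℚ), (0 : ℚ)⟩ : WeierstrassCurve.VariableChange ℚ) •
      ((⟨0, 1, 0, 3, -47⟩ : WeierstrassCurve ℤ).map (Int.castRingHom ℚ)) =
      ((⟨0, 1, 1, 1, 6⟩ : WeierstrassCurve ℤ).map (Int.castRingHom ℚ)).quadraticTwist ((NumberField.discr K : ℤ) : ℚ) := by
    rw [hD]; push_cast; exact minTwist8_smul_eq
  have hpD : ¬ (((5 : ℕ) : ℤ) ∣ NumberField.discr K) := by rw [hD]; decide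
  have hT := natCard_selmerGroup_quadraticTwist_le_iff_kuriharaBit hKim hSak1 hSak2 hnf hMaz _ 5 le_rfl goodOrdinary_5.1
    goodOrdinary_5.2 hsur (NumberField.discr_ne_zero K) hpD _ _ hC minTwist8_nonAnomalous_5 minTwist8_kodairaNeron_5 1
  rw [pow_one] at hT
  rw [exactRowZhang_5_neg8_rankFree h372 h84 K hK hD, and_iff_right hsha]
  exact hT

end C817a1

end Summit.BirchSwinnertonDyer.BirchSwinnertonDyer.Theorems.KolyvaginDepthDoor

end
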